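import Summits.Ventures.HodgeRepro2.T5SplittingTwist

/-!
# T5DualPairSwap — the factor-order bookkeeping of a dual pair (N3.10.2 / N3.11.4 (r5))

Kernel witness (cell pub-hodge-repro2, seat p3, Tier-5 support for sub-step N3) for the one-line
[A]s of route/T5-N3-route-2.md:

* §N3.10.2: «ω_{2,3} and ω_{3,2} are the same representation of the same pair with the factors
  named in the other order — one line, [A]»;
* §N3.11.4 (r5): «The one [A] line: the Weil representation of the product group
  U(V_v) × U(W₁₂,v) is the SAME representation whichever member is named first …»; and the
  «twin reading» of §N3.12.4: «a dual pair is an unordered pair, so Theorem 2.1 for (G′, G) in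
  place of (G, G′) gives (s1)–(s5) with the roles exchanged».

What is kernel-checked here (Mathlib + the cell's own `extTprod` of T5SplittingTwist, nothing
re-declared): for ANY representation `ω` of a product `G × H` on `V`,

* `swapRep ω` is the same representation read as a representation of `H × G`
  (`swapRep_apply`, `swapRep_swapRep`);
* `isIntertwiningMap_swap_iff`: `f : V → V₁ ⊗ V₂` intertwines `ω` with `σ ⊠ π` iff
  `comm ∘ f : V → V₂ ⊗ V₁` intertwines `swapRep ω` with `π ⊠ σ` — the Hom-spaces
  `Hom_{G×H}(ω, σ ⊠ π)` and `Hom_{H×G}(swapRep ω, π ⊠ σ)` correspond bijectively through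
  `TensorProduct.comm`, and non-zero maps to non-zero maps (`hasPartner_swap_iff`);
* `atMostOneRight_iff_atMostOneLeft_swap` / `atMostOneLeft_iff_atMostOneRight_swap`: the
  «at most one partner» statements (D_σ) / (D_π) for `(G, H, ω)` ARE the statements of the other
  shape for `(H, G, swapRep ω)` — so a uniqueness theorem proved for the pair «with the roles
  exchanged» gives the uniqueness of the other shape for the original pair;
* `hasPartner_congr_left`: the same transport when `ω'` is merely ISOMORPHIC to the swapped
  representation (`IsIso`), which is how «the same representation» is met in practice.

What stays prose (labels unchanged): that the cell's Weil representation of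
`U(V_v) × U(W₁₂,v)` and the printed `ω_{W,V,χ,ψ}` / `ω_{n,m}` are isomorphic (resp. isomorphic up
to the character twist of p8's reading Δ-N3.10-a, which is the twist machinery of
T5SplittingTwist) — this file only says what «the factors named in the other order» does to the
Hom-spaces and to the uniqueness statements.

README §8(d): this file uses an L-value-free non-vanishing device: NO.
-/

namespace Summit.Ventures.HodgeRepro2.T5DualPairSwap

open Summit.Ventures.HodgeRepro2.T5SplittingTwist (extTprod extTprod_apply)
open TensorProduct Representation

universe u

variable {k G H V V₁ V₂ : Type*} [CommSemiring k] [Monoid G] [Monoid H]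
  [AddCommMonoid V] [Module k V] [AddCommMonoid V₁] [Module k V₁] [AddCommMonoid V₂] [Module k V₂]

section Swap

/-- The representation of `H × G` obtained from a representation `ω` of `G × H` by naming the
factors in the other order: `swapRep ω (h, g) = ω (g, h)`. -/
def swapRep (ω : Representation k (G × H) V) : Representation k (H × G) V :=
  ω.comp (MulEquiv.prodComm : H × G ≃* G × H).toMonoidHom

/-- `swapRep ω (h, g) = ω (g, h)`: the same operator, the factors named in the other order. -/
@[simp]
theorem swapRep_apply (ω : Representation k (G × H) V) (h : H) (g : G) :
    swapRep ω (h, g) = ω (g, h) :=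
  rfl

/-- Naming the factors in the other order twice gives back `ω`. -/
@[simp]
theorem swapRep_swapRep (ω : Representation k (G × H) V) : swapRep (swapRep ω) = ω :=
  MonoidHom.ext fun _ => rfl

/-- `f : V → V₁ ⊗ V₂` intertwines `ω` with `σ ⊠ π` iff `comm ∘ f : V → V₂ ⊗ V₁` intertwines
`swapRep ω` with `π ⊠ σ`. -/
theorem isIntertwiningMap_swap_iff (ω : Representation k (G × H) V) (σ : Representation k G V₁)
    (π : Representation k H V₂) (f : V →ₗ[k] V₁ ⊗[k] V₂) :
    (swapRep ω).IsIntertwiningMap (extTprod π σ) ((TensorProduct.comm k V₁ V₂).toLinearMap ∘ₗ f) ↔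
      ω.IsIntertwiningMap (extTprod σ π) f := by
  constructor
  · intro hf
    refine ⟨fun g v => ?_⟩
    obtain ⟨g₁, g₂⟩ := g
    apply (TensorProduct.comm k V₁ V₂).injective
    have h := hf.isIntertwining (g₂, g₁) v
    simp only [LinearMap.comp_apply, LinearEquiv.coe_coe, swapRep_apply, extTprod_apply] at h ⊢
    rw [h, TensorProduct.map_comm]
  · intro hf
    refine ⟨fun p v => ?_⟩
    obtain ⟨h₀, g₀⟩ := p
    have h := hf.isIntertwining (g₀, h₀) v
    simp only [LinearMap.comp_apply, LinearEquiv.coe_coe, swapRep_apply, extTprod_apply] at h ⊢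
    rw [h, TensorProduct.map_comm]

/-- Composing with a linear equivalence preserves being non-zero. -/
theorem comp_linearEquiv_ne_zero {W W' : Type*} [AddCommMonoid W] [Module k W]
    [AddCommMonoid W'] [Module k W'] (e : W ≃ₗ[k] W') {f : V →ₗ[k] W} (hf : f ≠ 0) :
    e.toLinearMap ∘ₗ f ≠ 0 := by
  intro h
  apply hf
  ext v
  have := LinearMap.congr_fun h v
  simpa using this

end Swap

section Partner

/-- «Hom_{G×H}(ω, σ ⊠ π) ≠ 0»: there is a non-zero intertwining map from `ω` to the external
tensor product `σ ⊠ π` (the cell's «σ and π are partners under ω»). -/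
def HasPartner (ω : Representation k (G × H) V) (σ : Representation k G V₁)
    (π : Representation k H V₂) : Prop :=
  ∃ f : V →ₗ[k] V₁ ⊗[k] V₂, f ≠ 0 ∧ ω.IsIntertwiningMap (extTprod σ π) f

/-- Partners do not depend on the order in which the two members of the pair are named. -/
theorem hasPartner_swap_iff (ω : Representation k (G × H) V) (σ : Representation k G V₁)
    (π : Representation k H V₂) : HasPartner (swapRep ω) π σ ↔ HasPartner ω σ π := by
  constructor
  · rintro ⟨f, hf0, hf⟩
    refine ⟨(TensorProduct.comm k V₂ V₁).toLinearMap ∘ₗ f, comp_linearEquiv_ne_zero _ hf0, ?_⟩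
    have := (isIntertwiningMap_swap_iff (swapRep ω) π σ f).mpr hf
    rwa [swapRep_swapRep] at this
  · rintro ⟨f, hf0, hf⟩
    exact ⟨(TensorProduct.comm k V₁ V₂).toLinearMap ∘ₗ f, comp_linearEquiv_ne_zero _ hf0,
      (isIntertwiningMap_swap_iff ω σ π f).mpr hf⟩

/-- Isomorphism of two representations of a monoid `M` on (possibly different) spaces: an
intertwining linear equivalence. -/
def IsIso {M : Type*} [Monoid M] {W W' : Type*} [AddCommMonoid W] [Module k W]
    [AddCommMonoid W'] [Module k W'] (ρ : Representation k M W) (ρ' : Representation k M W') :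
    Prop :=
  ∃ e : W ≃ₗ[k] W', ρ.IsIntertwiningMap ρ' e.toLinearMap

/-- The inverse of an intertwining linear equivalence is intertwining. -/
theorem isIntertwiningMap_symm {M : Type*} [Monoid M] {W W' : Type*} [AddCommMonoid W]
    [Module k W] [AddCommMonoid W'] [Module k W'] {ρ : Representation k M W}
    {ρ' : Representation k M W'} {e : W ≃ₗ[k] W'} (he : ρ.IsIntertwiningMap ρ' e.toLinearMap) :
    ρ'.IsIntertwiningMap ρ e.symm.toLinearMap := by
  refine ⟨fun m w => e.injective ?_⟩
  have h := he.isIntertwining m (e.symm w)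
  simp only [LinearEquiv.coe_coe, LinearEquiv.apply_symm_apply] at h ⊢
  exact h.symm

/-- Isomorphism of representations is symmetric. -/
theorem IsIso.symm {M : Type*} [Monoid M] {W W' : Type*} [AddCommMonoid W] [Module k W]
    [AddCommMonoid W'] [Module k W'] {ρ : Representation k M W} {ρ' : Representation k M W'}
    (h : IsIso ρ ρ') : IsIso ρ' ρ :=
  let ⟨e, he⟩ := h
  ⟨e.symm, isIntertwiningMap_symm he⟩

/-- Precomposing an intertwining map with an intertwining map is intertwining. -/
theorem isIntertwiningMap_comp_of_isIso {M : Type*} [Monoid M] {W W' U : Type*}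
    [AddCommMonoid W] [Module k W] [AddCommMonoid W'] [Module k W'] [AddCommMonoid U]
    [Module k U] {ρ : Representation k M W} {ρ' : Representation k M W'} {τ : Representation k M U}
    {e : W →ₗ[k] W'} (he : ρ.IsIntertwiningMap ρ' e) {f : W' →ₗ[k] U}
    (hf : ρ'.IsIntertwiningMap τ f) : ρ.IsIntertwiningMap τ (f ∘ₗ e) :=
  ⟨fun m w => by simp only [LinearMap.comp_apply, he.isIntertwining, hf.isIntertwining]⟩

/-- If `ω'` is isomorphic to `ω`, they have the same partners. -/
theorem hasPartner_congr_left {V' : Type*} [AddCommMonoid V'] [Module k V']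
    {ω : Representation k (G × H) V} {ω' : Representation k (G × H) V'} (h : IsIso ω' ω)
    (σ : Representation k G V₁) (π : Representation k H V₂) :
    HasPartner ω' σ π ↔ HasPartner ω σ π := by
  obtain ⟨e, he⟩ := h
  constructor
  · rintro ⟨f, hf0, hf⟩
    refine ⟨f ∘ₗ e.symm.toLinearMap, ?_, isIntertwiningMap_comp_of_isIso (isIntertwiningMap_symm he) hf⟩
    intro h0
    apply hf0
    ext v
    have := LinearMap.congr_fun h0 (e v)
    simpa using this
  · rintro ⟨f, hf0, hf⟩
    refine ⟨f ∘ₗ e.toLinearMap, ?_, isIntertwiningMap_comp_of_isIso he hf⟩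
    intro h0
    apply hf0
    ext v
    have := LinearMap.congr_fun h0 (e.symm v)
    simpa using this

/-- (D_σ)-shape for the pair `(G, H, ω)` at `σ`: any two partners of `σ` on the second factor are
isomorphic («at most one irreducible partner»). -/
def AtMostOneRight (ω : Representation k (G × H) V) (σ : Representation k G V₁) : Prop :=
  ∀ (V₂ V₂' : Type u) [AddCommMonoid V₂] [Module k V₂] [AddCommMonoid V₂'] [Module k V₂']
    (π : Representation k H V₂) (π' : Representation k H V₂'),
    HasPartner ω σ π → HasPartner ω σ π' → IsIso π π'

/-- (D_π)-shape for the pair `(G, H, ω)` at `π`: any two partners of `π` on the first factor are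
isomorphic. -/
def AtMostOneLeft (ω : Representation k (G × H) V) (π : Representation k H V₂) : Prop :=
  ∀ (V₁ V₁' : Type u) [AddCommMonoid V₁] [Module k V₁] [AddCommMonoid V₁'] [Module k V₁']
    (σ : Representation k G V₁) (σ' : Representation k G V₁'),
    HasPartner ω σ π → HasPartner ω σ' π → IsIso σ σ'

/-- (r5): the (D_σ)-shape statement for `(G, H, ω)` at `σ` IS the (D_π)-shape statement for the
pair with the roles exchanged, `(H, G, swapRep ω)`, at `σ`. -/
theorem atMostOneRight_iff_atMostOneLeft_swap (ω : Representation k (G × H) V)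
    (σ : Representation k G V₁) :
    AtMostOneRight.{u} ω σ ↔ AtMostOneLeft.{u} (swapRep ω) σ := by
  constructor
  · intro h V₂ V₂' _ _ _ _ π π' h1 h2
    exact h V₂ V₂' π π' ((hasPartner_swap_iff ω σ π).mp h1) ((hasPartner_swap_iff ω σ π').mp h2)
  · intro h V₂ V₂' _ _ _ _ π π' h1 h2
    exact h V₂ V₂' π π' ((hasPartner_swap_iff ω σ π).mpr h1) ((hasPartner_swap_iff ω σ π').mpr h2)

/-- The other shape: the (D_π)-shape statement for `(G, H, ω)` at `π` IS the (D_σ)-shape statement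
for `(H, G, swapRep ω)` at `π`. -/
theorem atMostOneLeft_iff_atMostOneRight_swap (ω : Representation k (G × H) V)
    (π : Representation k H V₂) :
    AtMostOneLeft.{u} ω π ↔ AtMostOneRight.{u} (swapRep ω) π := by
  constructor
  · intro h V₁ V₁' _ _ _ _ σ σ' h1 h2
    exact h V₁ V₁' σ σ' ((hasPartner_swap_iff ω σ π).mp h1) ((hasPartner_swap_iff ω σ' π).mp h2)
  · intro h V₁ V₁' _ _ _ _ σ σ' h1 h2
    exact h V₁ V₁' σ σ' ((hasPartner_swap_iff ω σ π).mpr h1) ((hasPartner_swap_iff ω σ' π).mpr h2)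

/-- Uniqueness statements transport along an isomorphism of the pair's representation. -/
theorem atMostOneRight_congr {V' : Type*} [AddCommMonoid V'] [Module k V']
    {ω : Representation k (G × H) V} {ω' : Representation k (G × H) V'} (h : IsIso ω' ω)
    (σ : Representation k G V₁) : AtMostOneRight.{u} ω' σ ↔ AtMostOneRight.{u} ω σ := by
  constructor
  · intro h' V₂ V₂' _ _ _ _ π π' h1 h2
    exact h' V₂ V₂' π π' ((hasPartner_congr_left h σ π).mpr h1)
      ((hasPartner_congr_left h σ π').mpr h2)
  · intro h' V₂ V₂' _ _ _ _ π π' h1 h2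
    exact h' V₂ V₂' π π' ((hasPartner_congr_left h σ π).mp h1)
      ((hasPartner_congr_left h σ π').mp h2)

end Partner

end Summit.Ventures.HodgeRepro2.T5DualPairSwap
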